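import Literature.Computability.MetaComplexity.ModqImmunity
import Literature.Computability.MetaComplexity.HilbertFunctionLowerBound
import Literature.Computability.MetaComplexity.RobustHegedusLemma
import HarnessLib

/-!
# Cell qa-qnc0 (rung F-Q1, route RingFrame, crux α, line `product`): robust TWO-class avoidance —
# a low-degree `𝔽₂`-support is never concentrated on one residue class of the Hamming weight mod `q`

Planner statements HOME/qa-qnc0-p1/Sketch5.lean §18.2 (`TwoClassBound`, `TwoClassAvoidanceExplicit`,
there "THEOREM modulo `KSHilbertLower`"), now kernel theorems.  For `g : {0,1}ⁿ → 𝔽₂` of degree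
`≤ d`, `2d + 2 ≤ n`, support `B = {u : g u ≠ 0}`, an odd modulus `q ≥ 3` and a residue `r`, with
`A = B ∩ {u : |u| ≡ r (mod q)}` and `s = ⌈n/2⌉ − d − 1`:

* `card_class_add_hilbertFn_le_card_support` (`TwoClassBound`, Hilbert function in the tree's
  `Smolensky.hilbertFn` form) and `twoClassBound` (the planner's restriction/`funLeft` form,
  literally): `|A| + h_B(s) ≤ |B|`.  Proof (bypassing the planner's `RelSmolensky`/`HilbertDuality`
  detour): a degree-`≤ s` polynomial `p` vanishing on `B ∖ A` gives `g·p` of degree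
  `≤ d + s = ⌈n/2⌉ − 1 < n/2` supported inside ONE residue class, so `g·p = 0` by the immunity of
  `MOD_q` (Beck–Li 2013 Thm. 3.4, tree theorem `Smolensky.beckLi2013_thm34` at `p = 2`), i.e.
  `p|_B = 0`; hence `(lowDeg s)|_B` embeds into the functions on `B ∖ A` and `h_B(s) ≤ |B ∖ A|`.
* `twoClassAvoidanceExplicit` (`TwoClassAvoidanceExplicit`, literally):
  `2^{n+1}·|A| ≤ |B|·(2^{n+1} − Σ_{j < ⌈n/2⌉−d} C(n,j))`, from the two-class bound, the
  Keevash–Sudakov / GGHNY Hilbert-function lower bound `h_B(s) ≥ Σ_{j≤s} C(⌊log₂|B|⌋, j)` (tree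
  theorem `Smolensky.sum_choose_log_card_le_hilbertFn`) and monotonicity of binomial tails in the
  number of trials (`two_pow_mul_sum_choose_le`).  For `d ≤ c√n` the saved fraction tends to
  `½Φ(−2c)`; for `q > n` the classes are single Hamming layers.

The statements are the cell's (qa-qnc0 TARGET.md §18.2), not in print; the two library inputs are.
WHAT THIS IS NOT: a ONE-class bound (PLDAMS) — impossible by the Hilbert route (Smolensky's
half-bound, `SmolenskyHilbertHalf.lean`); nothing on `LDMAPolylog` or on α; no separation.

## References

* C. Beck, Y. Li, *Represent MOD function by low degree polynomial with unbounded one-sided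
  error*, arXiv:1304.0713 (2013), Thm. 3.4 [BeckLi2013].
* A. Golovnev, Z. Guo, P. Hatami, S. Nagargoje, C. Yan, *Hilbert functions and low-degree
  randomness extractors*, arXiv:2405.10277 (2024), Cor. 1 [GolovnevEtAl2024].
-/

noncomputable section

namespace Summit.QuantumAdvantage.AdviceFreeQNC0

open Finset Module
open Literature.Computability.MetaComplexity Literature.Computability.MetaComplexity.Smolensky
open Literature.Computability.MetaComplexity.Hegedus

variable {n : ℕ}

/-! ### Immunity of `MOD_q` over `𝔽₂` in the cell's vocabulary -/

/-- Beck–Li Thm. 3.4 at `p = 2`: for odd `q ≥ 3`, a function `f : {0,1}ⁿ → 𝔽₂` of degree `≤ t`,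
`2t < n`, supported inside `{u : |u| ≡ r (mod q)}` is zero. [cite: BeckLi2013, Theorem 3.4] -/
theorem eq_zero_of_lowDeg_F2_support_subset_modClass {q : ℕ} (hq : Odd q) (hq3 : 3 ≤ q) {t : ℕ}
    (ht : 2 * t < n) {f : CubeFn (ZMod 2) n} (hf : f ∈ lowDeg (ZMod 2) n t) (r : ℕ)
    (hsupp : ∀ u, f u ≠ 0 → wt u % q = r % q) : f = 0 :=
  haveI : Fact (Nat.Prime 2) := ⟨Nat.prime_two⟩
  beckLi2013_thm34 (p := 2) (by omega) (fun h => (Nat.not_even_iff_odd.2 hq) (even_iff_two_dvd.2 h))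
    ht hf r hsupp

/-! ### The two-class bound -/

/-- Pointwise formula for the tree's `projOn` (restated; the library copy is file-private). [folklore] -/
private theorem projOn_apply' (Y : Finset (Fin n → Bool)) (v : CubeFn (ZMod 2) n) (x : Fin n → Bool) :
    projOn (ZMod 2) Y v x = if x ∈ Y then v x else 0 :=
  rfl

/-- In `𝔽₂`, non-zero means `1`. [folklore] -/
private theorem zmod2_eq_one_of_ne_zero {x : ZMod 2} (hx : x ≠ 0) : x = 1 := by
  revert x; decide

/-- **`TwoClassBound` (planner Sketch5 §18.2), Hilbert-function form.** For `g ∈ lowDeg 𝔽₂ n d`,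
`2d + 2 ≤ n`, odd `q ≥ 3` and any `r`, with `B = {g ≠ 0}`:
`#{u ∈ B : |u| ≡ r (q)} + h_B(⌈n/2⌉ − d − 1) ≤ |B|`.  (The cell's statement; proof via Beck–Li
immunity: a degree-`≤ ⌈n/2⌉−d−1` polynomial vanishing on the other classes of `B` vanishes on `B`.)
[cite: BeckLi2013, Theorem 3.4] -/
theorem card_class_add_hilbertFn_le_card_support {d q r : ℕ} (hq : Odd q) (hq3 : 3 ≤ q)
    (hdn : 2 * d + 2 ≤ n) {g : CubeFn (ZMod 2) n} (hg : g ∈ lowDeg (ZMod 2) n d) :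
    (univ.filter fun u : Fin n → Bool => g u ≠ 0 ∧ wt u % q = r % q).card +
        hilbertFn (ZMod 2) (univ.filter fun u : Fin n → Bool => g u ≠ 0) ((n + 1) / 2 - d - 1) ≤
      (univ.filter fun u : Fin n → Bool => g u ≠ 0).card := by
  classical
  set B := univ.filter fun u : Fin n → Bool => g u ≠ 0 with hB
  set C := B.filter fun u : Fin n → Bool => ¬(wt u % q = r % q) with hC
  set s := (n + 1) / 2 - d - 1 with hs
  have hA : (univ.filter fun u : Fin n → Bool => g u ≠ 0 ∧ wt u % q = r % q) =
      B.filter fun u => wt u % q = r % q := by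
    rw [hB, Finset.filter_filter]
  have hAC : (B.filter fun u => wt u % q = r % q).card + C.card = B.card :=
    Finset.card_filter_add_card_filter_not _
  -- the key step: `h_B(s) ≤ |C|`
  have hkey : hilbertFn (ZMod 2) B s ≤ C.card := by
    unfold hilbertFn
    set M := (lowDeg (ZMod 2) n s).map (projOn (ZMod 2) B) with hM
    set L := (projOn (ZMod 2) C).domRestrict M with hL
    -- `L` is injective: a degree-`s` polynomial vanishing on `C` vanishes on `B`
    have hinj : Function.Injective L := by
      refine (injective_iff_map_eq_zero L).2 fun v hv => ?_
      obtain ⟨p, hp, hpv⟩ := Submodule.mem_map.1 v.2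
      rw [hL, LinearMap.domRestrict_apply] at hv
      -- `p` vanishes on `C`
      have hpC : ∀ u ∈ C, p u = 0 := by
        intro u hu
        have huB : u ∈ B := (Finset.mem_filter.1 hu).1
        have := congrFun hv u
        rw [projOn_apply', if_pos hu, ← hpv, projOn_apply', if_pos huB] at this
        exact this
      -- so `g·p` (degree `≤ d + s < n/2`) lives inside the class `r`, hence vanishes
      have hgp : g * p = 0 := by
        refine eq_zero_of_lowDeg_F2_support_subset_modClass hq hq3 (t := d + s) (by omega)
          (mul_mem_lowDeg_add hg hp) r fun u hu => ?_
        rw [Pi.mul_apply] at hu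
        have hgu : g u ≠ 0 := fun h => hu (by rw [h, zero_mul])
        have hpu : p u ≠ 0 := fun h => hu (by rw [h, mul_zero])
        by_contra hcl
        exact hpu (hpC u (Finset.mem_filter.2 ⟨Finset.mem_filter.2 ⟨Finset.mem_univ u, hgu⟩, hcl⟩))
      -- hence `v = p·𝟙_B = 0`
      apply Subtype.ext
      rw [← hpv, Submodule.coe_zero]
      funext u
      rw [projOn_apply', Pi.zero_apply]
      split_ifs with huB
      · have hgu : g u = 1 := zmod2_eq_one_of_ne_zero (Finset.mem_filter.1 huB).2
        have := congrFun hgp u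
        rwa [Pi.mul_apply, hgu, one_mul] at this
      · rfl
    -- its range sits inside the functions supported on `C`
    have hrange : LinearMap.range L ≤ suppOn (ZMod 2) C := by
      rintro _ ⟨v, rfl⟩
      rw [hL, LinearMap.domRestrict_apply]
      exact mem_suppOn_of_forall fun b hb => by rw [projOn_apply', if_neg hb]
    calc finrank (ZMod 2) M = finrank (ZMod 2) (LinearMap.range L) :=
          (LinearMap.finrank_range_of_inj hinj).symm
      _ ≤ finrank (ZMod 2) (suppOn (ZMod 2) C) := Submodule.finrank_mono hrange
      _ ≤ C.card := finrank_suppOn_le C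
  rw [hA]
  omega

/-- **`TwoClassBound`, literally the planner's shape** (Hilbert function as the dimension of the
restrictions `{p|_B : deg p ≤ s}`, via `LinearMap.funLeft`): for odd `q ≥ 3`, `2d + 2 ≤ n`,
`g ∈ lowDeg 𝔽₂ n d`, every `r`. [cite: BeckLi2013, Theorem 3.4] -/
theorem twoClassBound :
    ∀ n d q r : ℕ, Odd q → 3 ≤ q → 2 * d + 2 ≤ n → ∀ g : CubeFn (ZMod 2) n, g ∈ lowDeg (ZMod 2) n d →
      (univ.filter fun u : Fin n → Bool => g u ≠ 0 ∧ wt u % q = r % q).card +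
          Module.finrank (ZMod 2) ↥((lowDeg (ZMod 2) n ((n + 1) / 2 - d - 1)).map
            (LinearMap.funLeft (ZMod 2) (ZMod 2)
              (Subtype.val : ↥(univ.filter fun u : Fin n → Bool => g u ≠ 0) → (Fin n → Bool)))) ≤
        (univ.filter fun u : Fin n → Bool => g u ≠ 0).card := by
  intro n d q r hq hq3 hdn g hg
  rw [← hilbertFn_eq_finrank_map_funLeft]
  exact card_class_add_hilbertFn_le_card_support hq hq3 hdn hg

/-! ### Binomial tails are monotone in the number of trials -/

/-- `Σ_{j≤s} C(n+1, j) ≤ 2·Σ_{j≤s} C(n, j)` (Pascal). [folklore] -/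
theorem sum_choose_succ_le_two_mul (n s : ℕ) :
    ∑ j ∈ range (s + 1), (n + 1).choose j ≤ 2 * ∑ j ∈ range (s + 1), n.choose j := by
  rw [Finset.sum_range_succ', Nat.choose_zero_right]
  have h1 : ∑ j ∈ range s, (n + 1).choose (j + 1) =
      ∑ j ∈ range s, n.choose j + ∑ j ∈ range s, n.choose (j + 1) := by
    rw [← Finset.sum_add_distrib]
    exact Finset.sum_congr rfl fun j _ => Nat.choose_succ_succ' n j
  have h2 : ∑ j ∈ range (s + 1), n.choose j = ∑ j ∈ range s, n.choose (j + 1) + n.choose 0 :=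
    Finset.sum_range_succ' _ _
  have h3 : ∑ j ∈ range s, n.choose j ≤ ∑ j ∈ range (s + 1), n.choose j :=
    Finset.sum_le_sum_of_subset (Finset.range_mono (Nat.le_succ s))
  rw [Nat.choose_zero_right] at h2
  omega

/-- **Binomial tails decrease with the number of trials:** for `m ≤ n`,
`2^m · Σ_{j≤s} C(n,j) ≤ 2^n · Σ_{j≤s} C(m,j)`, i.e. `P[Bin(n,½) ≤ s] ≤ P[Bin(m,½) ≤ s]`. [folklore] -/
theorem two_pow_mul_sum_choose_le {m n : ℕ} (hmn : m ≤ n) (s : ℕ) :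
    2 ^ m * ∑ j ∈ range (s + 1), n.choose j ≤ 2 ^ n * ∑ j ∈ range (s + 1), m.choose j := by
  induction n, hmn using Nat.le_induction with
  | base => exact le_rfl
  | succ n hmn ih =>
    calc 2 ^ m * ∑ j ∈ range (s + 1), (n + 1).choose j
        ≤ 2 ^ m * (2 * ∑ j ∈ range (s + 1), n.choose j) :=
          Nat.mul_le_mul_left _ (sum_choose_succ_le_two_mul n s)
      _ = 2 * (2 ^ m * ∑ j ∈ range (s + 1), n.choose j) := by ring
      _ ≤ 2 * (2 ^ n * ∑ j ∈ range (s + 1), m.choose j) := Nat.mul_le_mul_left _ ih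
      _ = 2 ^ (n + 1) * ∑ j ∈ range (s + 1), m.choose j := by ring

/-! ### Two-class avoidance, explicit -/

/-- **`TwoClassAvoidanceExplicit` (planner Sketch5 §18.2), literally:** for odd `q ≥ 3`,
`2d + 2 ≤ n`, `g ∈ lowDeg 𝔽₂ n d` and every `r`,
`2^{n+1}·#{u : g u ≠ 0, |u| ≡ r (q)} ≤ #{u : g u ≠ 0}·(2^{n+1} − Σ_{j < ⌈n/2⌉ − d} C(n,j))`.
From the two-class bound (Beck–Li immunity) and the Keevash–Sudakov/GGHNY Hilbert-function lower
bound (tree theorem `Smolensky.sum_choose_log_card_le_hilbertFn`); the cell's statement.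
[cite: BeckLi2013, Theorem 3.4; GolovnevEtAl2024, Corollary 1] -/
theorem twoClassAvoidanceExplicit :
    ∀ n d q r : ℕ, Odd q → 3 ≤ q → 2 * d + 2 ≤ n → ∀ g : CubeFn (ZMod 2) n, g ∈ lowDeg (ZMod 2) n d →
      2 ^ (n + 1) * (univ.filter fun u : Fin n → Bool => g u ≠ 0 ∧ wt u % q = r % q).card ≤
        (univ.filter fun u : Fin n → Bool => g u ≠ 0).card *
          (2 ^ (n + 1) - ∑ j ∈ range ((n + 1) / 2 - d), Nat.choose n j) := by
  intro n d q r hq hq3 hdn g hg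
  classical
  set B := univ.filter fun u : Fin n → Bool => g u ≠ 0 with hB
  set A := univ.filter fun u : Fin n → Bool => g u ≠ 0 ∧ wt u % q = r % q with hA
  set s := (n + 1) / 2 - d - 1 with hs
  have hs1 : (n + 1) / 2 - d = s + 1 := by omega
  rw [hs1]
  set T := ∑ j ∈ range (s + 1), n.choose j with hT
  have hAB : A.card ≤ B.card := Finset.card_le_card (fun u hu => by
    rw [hA, Finset.mem_filter] at hu
    exact Finset.mem_filter.2 ⟨hu.1, hu.2.1⟩)
  by_cases hBe : B = ∅
  · have hA0 : A.card = 0 := by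
      have := hAB; rw [hBe, Finset.card_empty] at this; omega
    rw [hA0, hBe]
    simp
  have hBne : B.Nonempty := Finset.nonempty_iff_ne_empty.2 hBe
  -- the two inputs
  have h1 : A.card + hilbertFn (ZMod 2) B s ≤ B.card :=
    card_class_add_hilbertFn_le_card_support hq hq3 hdn hg
  set m := Nat.log 2 B.card with hm
  have h2 : ∑ j ∈ range (s + 1), m.choose j ≤ hilbertFn (ZMod 2) B s :=
    sum_choose_log_card_le_hilbertFn hBne s
  have h3 : B.card < 2 ^ (m + 1) := Nat.lt_pow_succ_log_self (by norm_num) _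
  have hmn : m ≤ n := by
    have hBcard : B.card ≤ 2 ^ n := by
      calc B.card ≤ (univ : Finset (Fin n → Bool)).card := Finset.card_le_card (Finset.subset_univ _)
        _ = 2 ^ n := by rw [Finset.card_univ, Fintype.card_fun, Fintype.card_bool, Fintype.card_fin]
    calc m ≤ Nat.log 2 (2 ^ n) := Nat.log_mono_right hBcard
      _ = n := Nat.log_pow (by norm_num) n
  have h4 := two_pow_mul_sum_choose_le hmn s
  have hTle : T ≤ 2 ^ n := by
    calc T ≤ ∑ j ∈ range (n + 1), n.choose j :=
          Finset.sum_le_sum_of_subset (Finset.range_mono (by omega))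
      _ = 2 ^ n := Nat.sum_range_choose n
  -- `|B|·T ≤ 2^{n+1}·(|B| − |A|)`
  have hBT : B.card * T ≤ 2 ^ (n + 1) * (B.card - A.card) := by
    calc B.card * T ≤ 2 ^ (m + 1) * T := Nat.mul_le_mul_right _ h3.le
      _ = 2 * (2 ^ m * T) := by ring
      _ ≤ 2 * (2 ^ n * ∑ j ∈ range (s + 1), m.choose j) := Nat.mul_le_mul_left _ h4
      _ = 2 ^ (n + 1) * ∑ j ∈ range (s + 1), m.choose j := by ring
      _ ≤ 2 ^ (n + 1) * (B.card - A.card) := Nat.mul_le_mul_left _ (by omega)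
  have hsum : 2 ^ (n + 1) * A.card + B.card * T ≤ B.card * 2 ^ (n + 1) := by
    calc 2 ^ (n + 1) * A.card + B.card * T ≤ 2 ^ (n + 1) * A.card + 2 ^ (n + 1) * (B.card - A.card) :=
          Nat.add_le_add_left hBT _
      _ = 2 ^ (n + 1) * (A.card + (B.card - A.card)) := by rw [Nat.mul_add]
      _ = B.card * 2 ^ (n + 1) := by rw [Nat.add_sub_cancel' hAB, Nat.mul_comm]
  rw [Nat.mul_sub]
  exact Nat.le_sub_of_add_le hsum

end Summit.QuantumAdvantage.AdviceFreeQNC0
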